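import Summits.PneNP.PneNP.Theses.PositionalGames
import Literature.Combinatorics.Games.ParityGame

/-!
# PneNP / PositionalGames — `ParityMonotonePoly` (stmt-PneNP-1299): the kill-switch relations

Route `PneNP/PositionalGames`, support item stmt-PneNP-1299 (`ParityMonotonePoly`, rank 9):

  `∃ k, ∀ᶠ n, ∀ o p v, circuitSizeOver monotoneBasis (WIN n o p v) ≤ n ^ k`

("parity games ∈ monotone P/poly"). The route files this statement as the NEGATIVE SIDE of its
rank-2 crux `ParityMonotoneSuperpoly` (M1, stmt-PneNP-1294) and of the sharp form
`ParityMonotoneQuasipolyLower` (stmt-PneNP-1297): "KILL CRITERIA. ParityMonotonePoly proved ⇒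
#2, #5 dead". This file proves exactly those two implications, i.e. the item is REFUTED as soon
as either crux lands:

* `parityMonotonePoly_false_of_ParityMonotoneSuperpoly : ParityMonotoneSuperpoly → ¬ ParityMonotonePoly`
  (pure `Filter` bookkeeping: `∀ᶠ` and `∀ᶠ` meet at some `n`);
* `parityMonotonePoly_false_of_ParityMonotoneQuasipolyLower :
    ParityMonotoneQuasipolyLower → ¬ ParityMonotonePoly`
  (`n ^ k < n ^ (c · log n)` once `k < c · log n` and `n ≥ 2`);
* `not_parityMonotonePoly_iff` — refuting the item means the infinitely-often (`∃ᶠ n`) version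
  of M1.

Mathematically the item itself is OPEN in both directions (grounder g13-35, refuter ac84c4a2):
a proof would put parity games in non-uniform (monotone) P, beating every universal-tree /
attractor-decomposition scheme (Czerwiński–Daviaud–Fijalkow–Jurdziński–Lazić–Parys 2019, Thm 3);
a refutation is a superpolynomial monotone circuit lower bound for parity games, the content of
crux M1. Nothing here is conditional; no new definitions.
-/

set_option linter.dupNamespace false -- `Summit.PneNP.PneNP.…`: summit = sub-problem name (D-0017 single-conjunct layout)

namespace Summit.PneNP.PneNP.Theorems.ParityMonotonePoly.Negative

open scoped Classical
open Filter
open Summit.PneNP.PneNP.Theses.PositionalGames (ParityMonotonePoly ParityMonotoneSuperpoly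
  ParityMonotoneQuasipolyLower)

/-- **Kill switch, weak form** (route PositionalGames, items 1294/1299): a superpolynomial
monotone lower bound for parity games holding for all large `n` (`ParityMonotoneSuperpoly`, M1)
refutes polynomial-size monotone circuits for all parity templates (`ParityMonotonePoly`): at the
exponent `k` of the latter, both eventualities hold at some common `n`, where some template has
monotone size `> n ^ k` and `≤ n ^ k`. [folklore] -/
theorem parityMonotonePoly_false_of_ParityMonotoneSuperpoly :
    ParityMonotoneSuperpoly → ¬ ParityMonotonePoly := by
  unfold Summit.PneNP.PneNP.Theses.PositionalGames.ParityMonotoneSuperpoly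
    Summit.PneNP.PneNP.Theses.PositionalGames.ParityMonotonePoly
  rintro hM ⟨k, hk⟩
  obtain ⟨n, ⟨o, p, v, hlt⟩, hle⟩ := ((hM k).and hk).exists
  exact absurd (hle o p v) (not_le.mpr hlt)

/-- **Kill switch, sharp form** (route PositionalGames, items 1297/1299): the universal-tree
shaped lower bound `n ^ (c · log n) ≤ mSIZE(WIN)` for some template and all large `n`
(`ParityMonotoneQuasipolyLower`, M1 sharp, `c > 0`) refutes `ParityMonotonePoly`: for `n ≥ 2`
with `k < c · log n` one has `n ^ k < n ^ (c · log n) ≤ mSIZE ≤ n ^ k`. [folklore] -/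
theorem parityMonotonePoly_false_of_ParityMonotoneQuasipolyLower :
    ParityMonotoneQuasipolyLower → ¬ ParityMonotonePoly := by
  unfold Summit.PneNP.PneNP.Theses.PositionalGames.ParityMonotoneQuasipolyLower
    Summit.PneNP.PneNP.Theses.PositionalGames.ParityMonotonePoly
  rintro ⟨c, hc, hM⟩ ⟨k, hk⟩
  -- eventually `k < c * log n`
  have hlog : Tendsto (fun n : ℕ => c * Real.log n) atTop atTop :=
    (Real.tendsto_log_atTop.comp tendsto_natCast_atTop_atTop).const_mul_atTop hc
  have hev : ∀ᶠ n : ℕ in atTop, (k : ℝ) < c * Real.log n := hlog.eventually_gt_atTop (k : ℝ)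
  obtain ⟨n, ⟨o, p, v, hge⟩, hle, hlt, hn2⟩ :=
    (hM.and (hk.and (hev.and (eventually_ge_atTop 2)))).exists
  have hn : (1 : ℝ) < n := by exact_mod_cast hn2
  have key : (n : ℝ) ^ (k : ℝ) < (n : ℝ) ^ (c * Real.log n) :=
    Real.rpow_lt_rpow_of_exponent_lt hn hlt
  rw [Real.rpow_natCast] at key
  have hle' := (Nat.cast_le (α := ℝ)).mpr (hle o p v)
  rw [Nat.cast_pow] at hle'
  exact absurd (hge.trans hle') (not_le.mpr key)

/-- **What refuting the item means** (`Filter` bookkeeping, for the record): `¬ ParityMonotonePoly`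
is the INFINITELY-OFTEN superpolynomial monotone lower bound for parity games — for every exponent
`k`, for infinitely many `n`, some template needs more than `n ^ k` monotone gates — i.e. crux M1
(`ParityMonotoneSuperpoly`, which asks this for all large `n`) with `∃ᶠ` in place of `∀ᶠ`. [folklore] -/
theorem not_parityMonotonePoly_iff :
    ¬ ParityMonotonePoly ↔ ∀ k : ℕ, ∃ᶠ n : ℕ in Filter.atTop,
      ∃ (o : Fin n → Bool) (p : Fin n → ℕ) (v : Fin n),
        n ^ k < Literature.Computability.Complexity.circuitSizeOver
          Literature.Computability.Complexity.monotoneBasis (fun x : Fin n × Fin n → Bool =>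
            decide (∃ σ : Fin n → Fin n, (∀ u, o u = true → x (u, σ u) = true) ∧
              ∀ τ : Fin n → Fin n, (∀ u, o u = false → x (u, τ u) = false) →
                Even ((Finset.univ.filter fun u : Fin n => ∃ᶠ t : ℕ in Filter.atTop,
                  (fun w : Fin n => if o w = true then σ w else τ w)^[t] v = u).sup p))) := by
  unfold Summit.PneNP.PneNP.Theses.PositionalGames.ParityMonotonePoly
  simp only [not_exists, Filter.not_eventually, not_forall, not_le]

/-! ## Appendix (seat prover-pitem-stmt-PneNP-1299-c1-0, 2026-08-16): the item over `winFn`,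
the kill criterion as stated by the route, and the domination of S1

Three further edges of the same sandwich, all elementary:
`ParityMonotoneQuasipolyLower ⟹ ParityMonotoneSuperpoly-type bounds ⟹ ¬ ParityMonotonePoly`
(above) and, downwards, `ParityMonotonePoly ⟹ ParityMonotoneQuasipolyUpper` (S1,
stmt-PneNP-1298); plus the restatement of the item over the Literature name
`Literature.Combinatorics.Games.ParityGame.winFn` of the inlined function (`winFn_eq_fin` is a
syntactic match), which is the form in which the tree's parity-game API
(`winFn_monotone`, `PositionalDeterminacy_holds`, …) applies to it. -/

/-- **`ParityMonotonePoly` over `winFn`.** The item says: for some `k`, for all large `n`, every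
parity template `(o, p, v)` on `Fin n` has
`circuitSizeOver monotoneBasis (ParityGame.winFn o p v) ≤ n ^ k`, where `ParityGame.winFn o p v`
is the Literature name of the route's inlined winning-region function ("parity games ∈ monotone
P/poly"). [folklore] -/
theorem parityMonotonePoly_iff_winFn :
    ParityMonotonePoly ↔ ∃ k : ℕ, ∀ᶠ n : ℕ in atTop, ∀ (o : Fin n → Bool) (p : Fin n → ℕ)
      (v : Fin n), Literature.Computability.Complexity.circuitSizeOver
        Literature.Computability.Complexity.monotoneBasis
          (Literature.Combinatorics.Games.ParityGame.winFn o p v) ≤ n ^ k := by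
  simp only [Summit.PneNP.PneNP.Theses.PositionalGames.ParityMonotonePoly,
    Literature.Combinatorics.Games.ParityGame.winFn_eq_fin]

/-- **The route's kill criterion, literally** ("ParityMonotonePoly proved ⇒ #2 dead"): the item
refutes crux M1 `ParityMonotoneSuperpoly` (stmt-PneNP-1294). Contrapositive of
`parityMonotonePoly_false_of_ParityMonotoneSuperpoly`. [folklore] -/
theorem not_parityMonotoneSuperpoly_of_parityMonotonePoly (h : ParityMonotonePoly) :
    ¬ ParityMonotoneSuperpoly :=
  fun hM => parityMonotonePoly_false_of_ParityMonotoneSuperpoly hM h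

/-- **The item dominates S1.** `ParityMonotonePoly` implies the quasi-polynomial monotone upper
bound `ParityMonotoneQuasipolyUpper` (stmt-PneNP-1298) with the same constant `c := k`:
`n ^ k ≤ n ^ (k · log₂ n + k)` for `n ≥ 1`. [folklore] -/
theorem parityMonotoneQuasipolyUpper_of_parityMonotonePoly (h : ParityMonotonePoly) :
    Summit.PneNP.PneNP.Theses.PositionalGames.ParityMonotoneQuasipolyUpper := by
  unfold Summit.PneNP.PneNP.Theses.PositionalGames.ParityMonotonePoly at h
  unfold Summit.PneNP.PneNP.Theses.PositionalGames.ParityMonotoneQuasipolyUpper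
  obtain ⟨k, hk⟩ := h
  refine ⟨k, (hk.and (eventually_ge_atTop 1)).mono fun n hn o p v => ?_⟩
  obtain ⟨hle, hn1⟩ := hn
  exact (hle o p v).trans (Nat.pow_le_pow_right hn1 (Nat.le_add_left k _))

end Summit.PneNP.PneNP.Theorems.ParityMonotonePoly.Negative
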